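import Summits.PneNP.PneNP.Theorems.KarlinRubinMonotoneBlindDnfBounds

/-!
# Crux `MonotoneBlind` (stmt-PneNP-18027, route KarlinRubin), line `Sketch`: stub `stub_weakBlindDnf`, counting core

The combinatorial core (exact, over `ℕ`, at one `n`) of the weak blindness of EVERY polynomial-term monotone
DNF (`stub_weakBlindDnf`, assembled in `KarlinRubinMonotoneBlindStubWeakBlindDnf.lean`). A monotone DNF on the
edge slots of `Kₙ` is its term family `𝓔`; it accepts `x` iff `∃ E ∈ 𝓔, E ⊆ x`. At a FAILURE point `x` (no term
inside `x`) write `E ∖ x := E.filter (x · = false)` (the missing slots of the term `E`), `V(M)` for the vertices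
met by an edge set `M`, `𝒱(x) := {V(E ∖ x) | E ∈ 𝓔}` and `Min(x)` for its inclusion-minimal members
(`Razborov.minimals`).

* `card_filter_plant_exists_le_sum_minimals` — **cover**: the planted sets `A` whose clique completes some
  term at `x` are covered by `⋃_{U ∈ Min(x)} {A ⊇ U}`;
* `card_kSubsets_filter_superset_mul_pow_le` — fibre factor `#{A ⊇ U} nʲ ≤ #kSubsets · dʲ` for `j ≤ |U|`;
* `card_filter_plant_exists_mul_pow_le` — per failure point:
  `#{A : f(plant A x) = 1} · n^{m+2} ≤ #kSubsets · (d² nᵐ · #{U ∈ Min(x) : |U| ≤ m+1} + d^{m+2} · #𝓔)`;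
* `card_filter_inside_card_le` — edge sets inside a vertex set `T` with `≤ r` slots number `≤ (|T|+1)^{2r}`;
* `sum_card_minimals_filter_mul_le` — **the pair count** (heart of the stub): summed over failure points,
  `#{(x, U) : U ∈ Min(x), |U| ≤ m+1} · 2^{w+1} ≤ 2^{C(n,2)} · ((2w+1)^{2r} 2^{w+1} + #𝓔 (n+1)^{2r})`,
  `r = C(m+1, 2)`, by the injection `(x, U) ↦ (x ∪ (E_U ∖ x), E_U ∖ x)`: at the accepted point `x⁺` the
  image `M` lies inside the vertex set of EVERY present term (minimality transfer), so it is one of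
  `≤ (2w+1)^{2r}` sets if a term with `≤ w` slots is present, and such "heavy" accepted points are few.

* `stub_weakBlindDnfCount` — the pair count in closed (registered) form.

All `--supports stmt-PneNP-18027`; no definitions.
-/

set_option linter.dupNamespace false -- `Summit.PneNP.PneNP.…` is the layout-mandated namespace

namespace Summit.PneNP.PneNP.Theorems.MonotoneBlind.VertexCover

open Literature.Computability.Complexity Literature.Probability.RandomGraphs.PlantedClique Filter Finset
open scoped ENNReal Topology Classical

variable {n : ℕ}

/-! ### Vertices of an edge set -/

/-- A nonempty edge set meets at least two vertices. [folklore] -/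
theorem two_le_card_vertices {M : Finset (⊤ : SimpleGraph (Fin n)).edgeSet} (hM : M.Nonempty) :
    2 ≤ #(univ.filter fun v : Fin n => ∃ e ∈ M, v ∈ (e : Sym2 (Fin n))) := by
  obtain ⟨e, he⟩ := hM
  rw [← card_filter_mem_edge e]
  exact card_le_card fun v hv => by
    rw [mem_filter] at hv ⊢
    exact ⟨hv.1, e, he, hv.2⟩

/-- An edge set has at most `C(|V(M)|, 2)` slots. [folklore] -/
theorem card_le_choose_card_vertices (M : Finset (⊤ : SimpleGraph (Fin n)).edgeSet) :
    #M ≤ (#(univ.filter fun v : Fin n => ∃ e ∈ M, v ∈ (e : Sym2 (Fin n)))).choose 2 := by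
  have h := card_filter_inside_le_choose (univ.filter fun v : Fin n => ∃ e ∈ M, v ∈ (e : Sym2 (Fin n))) M
  rw [inter_self, filter_true_of_mem] at h
  · exact h
  · intro e he v hv
    exact mem_filter.2 ⟨mem_univ _, e, he, hv⟩

/-- **Small edge sets inside a vertex set.** The edge sets with all endpoints in `T` and at most `r` slots
number at most `(|T| + 1)^{2r}` (they are the `≤ r`-subsets of the `≤ C(|T|,2)` slots inside `T`). [folklore] -/
theorem card_filter_inside_card_le (T : Finset (Fin n)) (r : ℕ) :
    #(univ.filter fun M : Finset (⊤ : SimpleGraph (Fin n)).edgeSet =>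
        (∀ e ∈ M, ∀ v ∈ (e : Sym2 (Fin n)), v ∈ T) ∧ #M ≤ r) ≤ (#T + 1) ^ (2 * r) := by
  set I := univ.filter fun e : (⊤ : SimpleGraph (Fin n)).edgeSet => ∀ v ∈ (e : Sym2 (Fin n)), v ∈ T with hI
  have hIcard : #I ≤ (#T).choose 2 :=
    (card_filter_inside_le_choose T (univ : Finset (⊤ : SimpleGraph (Fin n)).edgeSet)).trans
      (Nat.choose_le_choose 2 (card_le_card inter_subset_left))
  have hT2 : (#T).choose 2 + 1 ≤ (#T + 1) ^ 2 := by
    have h1 := Nat.choose_le_pow (#T) 2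
    have h2 : (#T + 1) ^ 2 = #T ^ 2 + 2 * #T + 1 := by ring
    omega
  calc #(univ.filter fun M : Finset (⊤ : SimpleGraph (Fin n)).edgeSet =>
          (∀ e ∈ M, ∀ v ∈ (e : Sym2 (Fin n)), v ∈ T) ∧ #M ≤ r)
      ≤ #((range (r + 1)).biUnion fun j => powersetCard j I) := by
        refine card_le_card fun M hM => ?_
        rw [mem_filter] at hM
        refine mem_biUnion.2 ⟨#M, mem_range.2 (Nat.lt_succ_of_le hM.2.2), mem_powersetCard.2 ⟨?_, rfl⟩⟩
        intro e he
        rw [hI, mem_filter]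
        exact ⟨mem_univ _, hM.2.1 e he⟩
    _ ≤ ∑ j ∈ range (r + 1), #(powersetCard j I) := card_biUnion_le
    _ = ∑ j ∈ range (r + 1), (#I).choose j := by simp only [card_powersetCard]
    _ ≤ ∑ j ∈ range (r + 1), (#I) ^ j := sum_le_sum fun j _ => Nat.choose_le_pow _ _
    _ ≤ (#I + 1) ^ r := Razborov.sum_range_pow_le_succ_pow _ _
    _ ≤ ((#T).choose 2 + 1) ^ r := Nat.pow_le_pow_left (by omega) _
    _ ≤ ((#T + 1) ^ 2) ^ r := Nat.pow_le_pow_left hT2 _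
    _ = (#T + 1) ^ (2 * r) := by rw [← pow_mul]

/-! ### The cover at a failure point and the fibre factor -/

/-- **Fibre factor.** A fixed vertex set `U` lies inside a uniform member of `kSubsets n k` with probability
`≤ (d/n)ʲ` for every `j ≤ |U|` (`d = min k n`), cross-multiplied. [folklore] -/
theorem card_kSubsets_filter_superset_mul_pow_le (U : Finset (Fin n)) (k : ℕ) {j : ℕ} (hj : j ≤ #U) :
    #((kSubsets n k).filter fun A => U ⊆ A) * n ^ j ≤ #(kSubsets n k) * (min k n) ^ j := by
  obtain ⟨U', hU'U, hU'card⟩ := exists_subset_card_eq hj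
  calc #((kSubsets n k).filter fun A => U ⊆ A) * n ^ j
      ≤ #((kSubsets n k).filter fun A => U' ⊆ A) * n ^ j := by
        refine Nat.mul_le_mul_right _ (card_le_card fun A hA => ?_)
        rw [mem_filter] at hA ⊢
        exact ⟨hA.1, hU'U.trans hA.2⟩
    _ ≤ #(kSubsets n k) * (min k n) ^ j := by
        rw [← hU'card]
        exact card_kSubsets_filter_superset_mul_le U' k

/-- **Cover.** The planted sets whose clique puts some term of `𝓔` inside `plant A x` are covered by the
super-set families of the inclusion-minimal members of `𝒱(x) = {V(E ∖ x)}`: a completed term `E` has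
`V(E ∖ x) ⊆ A`, and `V(E ∖ x)` contains a minimal member. [folklore] -/
theorem card_filter_plant_exists_le_sum_minimals (k : ℕ)
    (𝓔 : Finset (Finset (⊤ : SimpleGraph (Fin n)).edgeSet)) (x : EdgeVec n) :
    #((kSubsets n k).filter fun A => ∃ E ∈ 𝓔, ∀ e ∈ E, plant A x e = true) ≤
      ∑ U ∈ Razborov.minimals (𝓔.image fun E => univ.filter fun v : Fin n =>
          ∃ e : (⊤ : SimpleGraph (Fin n)).edgeSet, e ∈ E.filter (fun e => x e = false) ∧ v ∈ (e : Sym2 (Fin n))),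
        #((kSubsets n k).filter fun A => U ⊆ A) := by
  refine le_trans (card_le_card fun A hA => ?_) card_biUnion_le
  rw [mem_filter] at hA
  obtain ⟨hAKS, E, hE, hEA⟩ := hA
  have hW : (univ.filter fun v : Fin n => ∃ e : (⊤ : SimpleGraph (Fin n)).edgeSet, e ∈ E.filter (fun e => x e = false) ∧ v ∈ (e : Sym2 (Fin n))) ∈
      𝓔.image fun E => univ.filter fun v : Fin n =>
        ∃ e : (⊤ : SimpleGraph (Fin n)).edgeSet, e ∈ E.filter (fun e => x e = false) ∧ v ∈ (e : Sym2 (Fin n)) := mem_image_of_mem _ hE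
  obtain ⟨U, hU, hUW⟩ := Razborov.exists_minimal_subset hW
  refine mem_biUnion.2 ⟨U, hU, mem_filter.2 ⟨hAKS, hUW.trans fun v hv => ?_⟩⟩
  rw [mem_filter] at hv
  obtain ⟨-, e, he, hve⟩ := hv
  rw [mem_filter] at he
  rcases (plant_apply_eq_true_iff A x e).1 (hEA e he.1) with h | h
  · rw [he.2] at h
    exact absurd h Bool.false_ne_true
  · exact h v hve

/-- **Per failure point.** If no term is inside `x`, then (`d = min k n`)
`#{A : some term inside plant A x} · n^{m+2} ≤ #kSubsets · (d² nᵐ · #{U ∈ Min(x) : |U| ≤ m+1} + d^{m+2} · #𝓔)`: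
cover by `Min(x)`, fibre factor with exponent `2 ≤ |U|` (every `E ∖ x` is nonempty) for the small `U` and
`m + 2` for the large ones, of which there are `≤ #𝓔`. [folklore] -/
theorem card_filter_plant_exists_mul_pow_le (k m : ℕ)
    (𝓔 : Finset (Finset (⊤ : SimpleGraph (Fin n)).edgeSet)) (x : EdgeVec n)
    (hx : ¬ ∃ E ∈ 𝓔, ∀ e ∈ E, x e = true) :
    #((kSubsets n k).filter fun A => ∃ E ∈ 𝓔, ∀ e ∈ E, plant A x e = true) * n ^ (m + 2) ≤
      #(kSubsets n k) * ((min k n) ^ 2 * n ^ m *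
        #((Razborov.minimals (𝓔.image fun E => univ.filter fun v : Fin n =>
            ∃ e : (⊤ : SimpleGraph (Fin n)).edgeSet, e ∈ E.filter (fun e => x e = false) ∧ v ∈ (e : Sym2 (Fin n)))).filter fun U => #U ≤ m + 1) +
        (min k n) ^ (m + 2) * #𝓔) := by
  set 𝒱 := 𝓔.image fun E => univ.filter fun v : Fin n =>
    ∃ e : (⊤ : SimpleGraph (Fin n)).edgeSet, e ∈ E.filter (fun e => x e = false) ∧ v ∈ (e : Sym2 (Fin n)) with h𝒱
  set KS := kSubsets n k with hKS
  set d := min k n with hd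
  -- every member of `𝒱` has at least two vertices
  have htwo : ∀ U ∈ Razborov.minimals 𝒱, 2 ≤ #U := by
    intro U hU
    obtain ⟨E, hE, rfl⟩ := mem_image.1 (Razborov.minimals_subset _ hU)
    refine two_le_card_vertices ?_
    push Not at hx
    obtain ⟨e, he, hxe⟩ := hx E hE
    exact ⟨e, mem_filter.2 ⟨he, by simpa using hxe⟩⟩
  have hsmall : ∀ U ∈ (Razborov.minimals 𝒱).filter (fun U => #U ≤ m + 1),
      #(KS.filter fun A => U ⊆ A) * n ^ (m + 2) ≤ #KS * (d ^ 2 * n ^ m) := by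
    intro U hU
    rw [mem_filter] at hU
    calc #(KS.filter fun A => U ⊆ A) * n ^ (m + 2) = #(KS.filter fun A => U ⊆ A) * n ^ 2 * n ^ m := by ring
      _ ≤ #KS * d ^ 2 * n ^ m :=
          Nat.mul_le_mul_right _ (card_kSubsets_filter_superset_mul_pow_le U k (htwo U hU.1))
      _ = #KS * (d ^ 2 * n ^ m) := by ring
  have hlarge : ∀ U ∈ (Razborov.minimals 𝒱).filter (fun U => ¬ #U ≤ m + 1),
      #(KS.filter fun A => U ⊆ A) * n ^ (m + 2) ≤ #KS * d ^ (m + 2) := by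
    intro U hU
    rw [mem_filter] at hU
    exact card_kSubsets_filter_superset_mul_pow_le U k (by omega)
  have hcount : #((Razborov.minimals 𝒱).filter fun U => ¬ #U ≤ m + 1) ≤ #𝓔 :=
    ((card_le_card (filter_subset _ _)).trans (card_le_card (Razborov.minimals_subset _))).trans card_image_le
  calc #(KS.filter fun A => ∃ E ∈ 𝓔, ∀ e ∈ E, plant A x e = true) * n ^ (m + 2)
      ≤ (∑ U ∈ Razborov.minimals 𝒱, #(KS.filter fun A => U ⊆ A)) * n ^ (m + 2) :=
        Nat.mul_le_mul_right _ (card_filter_plant_exists_le_sum_minimals k 𝓔 x)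
    _ = ∑ U ∈ (Razborov.minimals 𝒱).filter (fun U => #U ≤ m + 1), #(KS.filter fun A => U ⊆ A) * n ^ (m + 2) +
          ∑ U ∈ (Razborov.minimals 𝒱).filter (fun U => ¬ #U ≤ m + 1),
            #(KS.filter fun A => U ⊆ A) * n ^ (m + 2) := by
        rw [sum_mul, sum_filter_add_sum_filter_not]
    _ ≤ ∑ _U ∈ (Razborov.minimals 𝒱).filter (fun U => #U ≤ m + 1), #KS * (d ^ 2 * n ^ m) +
          ∑ _U ∈ (Razborov.minimals 𝒱).filter (fun U => ¬ #U ≤ m + 1), #KS * d ^ (m + 2) :=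
        Nat.add_le_add (sum_le_sum hsmall) (sum_le_sum hlarge)
    _ = #KS * (d ^ 2 * n ^ m * #((Razborov.minimals 𝒱).filter fun U => #U ≤ m + 1)) +
          #((Razborov.minimals 𝒱).filter fun U => ¬ #U ≤ m + 1) * (#KS * d ^ (m + 2)) := by
        rw [sum_const, sum_const, smul_eq_mul, smul_eq_mul]; ring
    _ ≤ #KS * (d ^ 2 * n ^ m * #((Razborov.minimals 𝒱).filter fun U => #U ≤ m + 1)) +
          #𝓔 * (#KS * d ^ (m + 2)) := Nat.add_le_add_left (Nat.mul_le_mul_right _ hcount) _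
    _ = #KS * (d ^ 2 * n ^ m * #((Razborov.minimals 𝒱).filter fun U => #U ≤ m + 1) + d ^ (m + 2) * #𝓔) := by
        ring

/-! ### The pair count -/

/-- **The pair count** (heart of `stub_weakBlindDnf`). Summed over the failure points `x` of the DNF, the number
of inclusion-minimal missing vertex sets `U ∈ Min(x)` with `|U| ≤ m + 1`, times `2^{w+1}`, is at most
`#EdgeVec · ((2w+1)^{2r} 2^{w+1} + #𝓔 (n+1)^{2r})`, `r = C(m+1, 2)`. Proof: choose a term `E_U` with
`V(E_U ∖ x) = U`, put `M := E_U ∖ x` and `x⁺ := x ∪ M` (an ACCEPTED point). The map `(x, U) ↦ (x⁺, M)` is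
injective (`x = x⁺ ∖ M`, `U = V(M)`), `|M| ≤ C(|U|, 2) ≤ r`, and — minimality transfer — `V(M) ⊆ V(E')` for EVERY
term `E'` present at `x⁺` (`E' ∖ x ⊆ M`, so `V(E' ∖ x) ⊆ U` is a member of `𝒱(x)` below the minimal `U`). At an
accepted point with a present term of `≤ w` slots there are `≤ (2w+1)^{2r}` such `M`
(`card_filter_inside_card_le`); the other accepted points contain a term with `> w` slots, so they number
`≤ #𝓔 · #EdgeVec / 2^{w+1}`, with `≤ (n+1)^{2r}` sets `M` each. [folklore] -/
theorem sum_card_minimals_filter_mul_le (𝓔 : Finset (Finset (⊤ : SimpleGraph (Fin n)).edgeSet)) (m w : ℕ) :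
    (∑ x ∈ univ.filter (fun x : EdgeVec n => ¬ ∃ E ∈ 𝓔, ∀ e ∈ E, x e = true),
        #((Razborov.minimals (𝓔.image fun E => univ.filter fun v : Fin n =>
            ∃ e : (⊤ : SimpleGraph (Fin n)).edgeSet, e ∈ E.filter (fun e => x e = false) ∧
              v ∈ (e : Sym2 (Fin n)))).filter fun U => #U ≤ m + 1)) * 2 ^ (w + 1) ≤
      Fintype.card (EdgeVec n) *
        ((2 * w + 1) ^ (2 * (m + 1).choose 2) * 2 ^ (w + 1) + #𝓔 * (n + 1) ^ (2 * (m + 1).choose 2)) := by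
  set r := (m + 1).choose 2 with hr
  set Sc := univ.filter (fun x : EdgeVec n => ¬ ∃ E ∈ 𝓔, ∀ e ∈ E, x e = true) with hSc
  set Sf := univ.filter (fun y : EdgeVec n => ∃ E ∈ 𝓔, ∀ e ∈ E, y e = true) with hSf
  -- the small minimal missing vertex sets at a failure point `x`
  set F : EdgeVec n → Finset (Finset (Fin n)) := fun x =>
    (Razborov.minimals (𝓔.image fun E => univ.filter fun v : Fin n =>
      ∃ e : (⊤ : SimpleGraph (Fin n)).edgeSet, e ∈ E.filter (fun e => x e = false) ∧
        v ∈ (e : Sym2 (Fin n)))).filter fun U => #U ≤ m + 1 with hF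
  -- the admissible edge sets at an accepted point `y`: inside `V(E)` for every present term `E`, `≤ r` slots
  set G : EdgeVec n → Finset (Finset (⊤ : SimpleGraph (Fin n)).edgeSet) := fun y =>
    univ.filter fun M : Finset (⊤ : SimpleGraph (Fin n)).edgeSet =>
      (∀ E ∈ 𝓔, (∀ e ∈ E, y e = true) → ∀ e ∈ M, ∀ v ∈ (e : Sym2 (Fin n)),
        v ∈ (univ.filter fun u : Fin n => ∃ e' ∈ E, u ∈ (e' : Sym2 (Fin n)))) ∧ #M ≤ r with hG
  /- Step A: the injection `(x, U) ↦ (x⁺, M)` -/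
  have hA : ∑ x ∈ Sc, #(F x) ≤ ∑ y ∈ Sf, #(G y) := by
    rw [← card_sigma, ← card_sigma]
    -- membership in the domain, unpacked
    have hdom : ∀ p ∈ Sc.sigma F, (¬ ∃ E ∈ 𝓔, ∀ e ∈ E, p.1 e = true) ∧ #p.2 ≤ m + 1 ∧
        (∃ E ∈ 𝓔, (univ.filter fun v : Fin n => ∃ e : (⊤ : SimpleGraph (Fin n)).edgeSet,
          e ∈ E.filter (fun e => p.1 e = false) ∧ v ∈ (e : Sym2 (Fin n))) = p.2) ∧
        (∀ E' ∈ 𝓔, (univ.filter fun v : Fin n => ∃ e : (⊤ : SimpleGraph (Fin n)).edgeSet,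
            e ∈ E'.filter (fun e => p.1 e = false) ∧ v ∈ (e : Sym2 (Fin n))) ⊆ p.2 →
          (univ.filter fun v : Fin n => ∃ e : (⊤ : SimpleGraph (Fin n)).edgeSet,
            e ∈ E'.filter (fun e => p.1 e = false) ∧ v ∈ (e : Sym2 (Fin n))) = p.2) := by
      intro p hp
      rw [mem_sigma] at hp
      obtain ⟨hx, hU⟩ := hp
      rw [hSc, mem_filter] at hx
      simp only [hF] at hU
      rw [mem_filter, Razborov.mem_minimals] at hU
      obtain ⟨⟨hU𝒱, hmin⟩, hUm⟩ := hU
      refine ⟨hx.2, hUm, by simpa only [mem_image] using hU𝒱, fun E' hE' hsub => ?_⟩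
      exact hmin _ (mem_image_of_mem _ hE') hsub
    -- the map
    let f : (Σ _ : EdgeVec n, Finset (Fin n)) → (Σ _ : EdgeVec n, Finset (⊤ : SimpleGraph (Fin n)).edgeSet) :=
      fun p => if h : ∃ E ∈ 𝓔, (univ.filter fun v : Fin n => ∃ e : (⊤ : SimpleGraph (Fin n)).edgeSet,
          e ∈ E.filter (fun e => p.1 e = false) ∧ v ∈ (e : Sym2 (Fin n))) = p.2 then
        ⟨fun e => p.1 e || decide (e ∈ (Classical.choose h).filter fun e => p.1 e = false),
          (Classical.choose h).filter fun e => p.1 e = false⟩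
      else ⟨p.1, ∅⟩
    refine card_le_card_of_injOn f (fun p hp => ?_) (fun p₁ hp₁ p₂ hp₂ hfeq => ?_)
    · -- maps into the admissible pairs
      obtain ⟨hx, hUm, hex, hmin⟩ := hdom p hp
      rw [mem_coe]
      simp only [f, dif_pos hex]
      set E := Classical.choose hex with hEdef
      have hE : E ∈ 𝓔 ∧ (univ.filter fun v : Fin n => ∃ e : (⊤ : SimpleGraph (Fin n)).edgeSet,
          e ∈ E.filter (fun e => p.1 e = false) ∧ v ∈ (e : Sym2 (Fin n))) = p.2 := Classical.choose_spec hex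
      set M := E.filter (fun e => p.1 e = false) with hM
      rw [mem_sigma]
      constructor
      · -- `x⁺` is accepted: `E` is present
        rw [hSf, mem_filter]
        refine ⟨mem_univ _, E, hE.1, fun e he => ?_⟩
        by_cases hpe : p.1 e = true
        · simp [hpe]
        · have heM : e ∈ M := mem_filter.2 ⟨he, by simpa using hpe⟩
          simp [heM]
      · simp only [hG]
        rw [mem_filter]
        refine ⟨mem_univ _, fun E' hE' hy e he v hv => ?_, ?_⟩
        · -- minimality transfer
          have hsub : E'.filter (fun e => p.1 e = false) ⊆ M := by
            intro e₁ he₁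
            rw [mem_filter] at he₁
            have h := hy e₁ he₁.1
            simp only [he₁.2, Bool.false_or, decide_eq_true_eq] at h
            exact h
          have hVsub : (univ.filter fun v : Fin n => ∃ e : (⊤ : SimpleGraph (Fin n)).edgeSet,
              e ∈ E'.filter (fun e => p.1 e = false) ∧ v ∈ (e : Sym2 (Fin n))) ⊆ p.2 := by
            rw [← hE.2]
            intro u hu
            rw [mem_filter] at hu ⊢
            obtain ⟨-, e₁, he₁, hue⟩ := hu
            exact ⟨mem_univ _, e₁, hsub he₁, hue⟩
          have hVeq := hmin E' hE' hVsub
          have hvU : v ∈ p.2 := by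
            rw [← hE.2]
            exact mem_filter.2 ⟨mem_univ _, e, he, hv⟩
          rw [← hVeq, mem_filter] at hvU
          obtain ⟨-, e₁, he₁, hve₁⟩ := hvU
          exact mem_filter.2 ⟨mem_univ _, e₁, (mem_filter.1 he₁).1, hve₁⟩
        · -- `|M| ≤ C(|U|, 2) ≤ r`
          have h1 := card_le_choose_card_vertices M
          rw [hE.2] at h1
          exact h1.trans (Nat.choose_le_choose 2 hUm)
    · -- injective: `x = x⁺ ∖ M`, `U = V(M)`
      obtain ⟨-, -, hex₁, -⟩ := hdom p₁ hp₁
      obtain ⟨-, -, hex₂, -⟩ := hdom p₂ hp₂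
      simp only [f, dif_pos hex₁, dif_pos hex₂] at hfeq
      obtain ⟨hy, hMM⟩ := Sigma.mk.inj_iff.1 hfeq
      have hM := eq_of_heq hMM
      have hE₁ := Classical.choose_spec hex₁
      have hE₂ := Classical.choose_spec hex₂
      have h1 : p₁.1 = p₂.1 := by
        funext e
        have hye := congr_fun hy e
        by_cases he : e ∈ (Classical.choose hex₁).filter (fun e => p₁.1 e = false)
        · have he₂ : e ∈ (Classical.choose hex₂).filter (fun e => p₂.1 e = false) := hM ▸ he
          rw [(mem_filter.1 he).2, (mem_filter.1 he₂).2]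
        · have he₂ : e ∉ (Classical.choose hex₂).filter (fun e => p₂.1 e = false) := hM ▸ he
          simp only [he, he₂, decide_false, Bool.or_false] at hye
          exact hye
      have h2 : p₁.2 = p₂.2 := by
        rw [← hE₁.2, ← hE₂.2, hM]
      exact Sigma.ext h1 (heq_of_eq h2)
  /- Step B: counting the admissible pairs -/
  have hlight : ∀ y ∈ Sf.filter (fun y => ∃ E ∈ 𝓔, (∀ e ∈ E, y e = true) ∧ #E ≤ w),
      #(G y) ≤ (2 * w + 1) ^ (2 * r) := by
    intro y hy
    obtain ⟨-, E₀, hE₀, hE₀y, hE₀w⟩ := mem_filter.1 hy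
    calc #(G y) ≤ #(univ.filter fun M : Finset (⊤ : SimpleGraph (Fin n)).edgeSet =>
          (∀ e ∈ M, ∀ v ∈ (e : Sym2 (Fin n)), v ∈ (univ.filter fun u : Fin n => ∃ e' ∈ E₀, u ∈ (e' : Sym2 (Fin n)))) ∧
            #M ≤ r) := by
          refine card_le_card fun M hM => ?_
          simp only [hG] at hM
          rw [mem_filter] at hM ⊢
          exact ⟨mem_univ _, hM.2.1 E₀ hE₀ hE₀y, hM.2.2⟩
      _ ≤ (#(univ.filter fun u : Fin n => ∃ e' ∈ E₀, u ∈ (e' : Sym2 (Fin n))) + 1) ^ (2 * r) :=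
          card_filter_inside_card_le _ r
      _ ≤ (2 * w + 1) ^ (2 * r) :=
          Nat.pow_le_pow_left (Nat.succ_le_succ ((card_vertices_le_two_mul_card E₀).trans
            (Nat.mul_le_mul_left 2 hE₀w))) _
  have hheavy : ∀ y ∈ Sf.filter (fun y => ¬ ∃ E ∈ 𝓔, (∀ e ∈ E, y e = true) ∧ #E ≤ w),
      #(G y) ≤ (n + 1) ^ (2 * r) := by
    intro y _
    calc #(G y) ≤ #(univ.filter fun M : Finset (⊤ : SimpleGraph (Fin n)).edgeSet =>
          (∀ e ∈ M, ∀ v ∈ (e : Sym2 (Fin n)), v ∈ (univ : Finset (Fin n))) ∧ #M ≤ r) := by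
          refine card_le_card fun M hM => ?_
          simp only [hG] at hM
          rw [mem_filter] at hM ⊢
          exact ⟨mem_univ _, fun e _ v _ => mem_univ _, hM.2.2⟩
      _ ≤ (#(univ : Finset (Fin n)) + 1) ^ (2 * r) := card_filter_inside_card_le _ r
      _ = (n + 1) ^ (2 * r) := by rw [card_univ, Fintype.card_fin]
  have hEV : Fintype.card (EdgeVec n) = 2 ^ Fintype.card (⊤ : SimpleGraph (Fin n)).edgeSet := by
    rw [Fintype.card_fun, Fintype.card_bool]
  have hheavycount : #(Sf.filter fun y => ¬ ∃ E ∈ 𝓔, (∀ e ∈ E, y e = true) ∧ #E ≤ w) * 2 ^ (w + 1) ≤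
      #𝓔 * Fintype.card (EdgeVec n) := by
    have hcov : (Sf.filter fun y => ¬ ∃ E ∈ 𝓔, (∀ e ∈ E, y e = true) ∧ #E ≤ w) ⊆
        (𝓔.filter fun E => w + 1 ≤ #E).biUnion fun E => univ.filter fun y : EdgeVec n => ∀ e ∈ E, y e = true := by
      intro y hy
      rw [mem_filter, hSf, mem_filter] at hy
      obtain ⟨⟨-, E, hE, hEy⟩, hnot⟩ := hy
      refine mem_biUnion.2 ⟨E, mem_filter.2 ⟨hE, ?_⟩, mem_filter.2 ⟨mem_univ _, hEy⟩⟩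
      by_contra hlt
      exact hnot ⟨E, hE, hEy, by omega⟩
    calc #(Sf.filter fun y => ¬ ∃ E ∈ 𝓔, (∀ e ∈ E, y e = true) ∧ #E ≤ w) * 2 ^ (w + 1)
        ≤ #((𝓔.filter fun E => w + 1 ≤ #E).biUnion fun E =>
            univ.filter fun y : EdgeVec n => ∀ e ∈ E, y e = true) * 2 ^ (w + 1) :=
          Nat.mul_le_mul_right _ (card_le_card hcov)
      _ ≤ (∑ E ∈ 𝓔.filter (fun E => w + 1 ≤ #E), #(univ.filter fun y : EdgeVec n => ∀ e ∈ E, y e = true)) *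
            2 ^ (w + 1) := Nat.mul_le_mul_right _ card_biUnion_le
      _ = ∑ E ∈ 𝓔.filter (fun E => w + 1 ≤ #E), #(univ.filter fun y : EdgeVec n => ∀ e ∈ E, y e = true) *
            2 ^ (w + 1) := sum_mul _ _ _
      _ ≤ ∑ _E ∈ 𝓔.filter (fun E => w + 1 ≤ #E), 2 ^ Fintype.card (⊤ : SimpleGraph (Fin n)).edgeSet := by
          refine sum_le_sum fun E hE => ?_
          rw [mem_filter] at hE
          calc #(univ.filter fun y : EdgeVec n => ∀ e ∈ E, y e = true) * 2 ^ (w + 1)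
              ≤ #(univ.filter fun y : EdgeVec n => ∀ e ∈ E, y e = true) * 2 ^ #E :=
                Nat.mul_le_mul_left _ (Nat.pow_le_pow_right two_pos hE.2)
            _ ≤ 2 ^ Fintype.card (⊤ : SimpleGraph (Fin n)).edgeSet := card_filter_forall_eq_true_mul_le E
      _ = #(𝓔.filter fun E => w + 1 ≤ #E) * Fintype.card (EdgeVec n) := by rw [sum_const, smul_eq_mul, hEV]
      _ ≤ #𝓔 * Fintype.card (EdgeVec n) := Nat.mul_le_mul_right _ (card_le_card (filter_subset _ _))
  /- assembly -/
  calc (∑ x ∈ Sc, #(F x)) * 2 ^ (w + 1) ≤ (∑ y ∈ Sf, #(G y)) * 2 ^ (w + 1) := Nat.mul_le_mul_right _ hA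
    _ = (∑ y ∈ Sf.filter (fun y => ∃ E ∈ 𝓔, (∀ e ∈ E, y e = true) ∧ #E ≤ w), #(G y) +
          ∑ y ∈ Sf.filter (fun y => ¬ ∃ E ∈ 𝓔, (∀ e ∈ E, y e = true) ∧ #E ≤ w), #(G y)) * 2 ^ (w + 1) := by
        rw [sum_filter_add_sum_filter_not]
    _ ≤ (#(Sf.filter fun y => ∃ E ∈ 𝓔, (∀ e ∈ E, y e = true) ∧ #E ≤ w) * (2 * w + 1) ^ (2 * r) +
          #(Sf.filter fun y => ¬ ∃ E ∈ 𝓔, (∀ e ∈ E, y e = true) ∧ #E ≤ w) * (n + 1) ^ (2 * r)) *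
            2 ^ (w + 1) := by
        refine Nat.mul_le_mul_right _ (Nat.add_le_add ?_ ?_)
        · exact (sum_le_sum hlight).trans (by rw [sum_const, smul_eq_mul])
        · exact (sum_le_sum hheavy).trans (by rw [sum_const, smul_eq_mul])
    _ = #(Sf.filter fun y => ∃ E ∈ 𝓔, (∀ e ∈ E, y e = true) ∧ #E ≤ w) * ((2 * w + 1) ^ (2 * r) * 2 ^ (w + 1)) +
          #(Sf.filter fun y => ¬ ∃ E ∈ 𝓔, (∀ e ∈ E, y e = true) ∧ #E ≤ w) * 2 ^ (w + 1) * (n + 1) ^ (2 * r) := by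
        ring
    _ ≤ Fintype.card (EdgeVec n) * ((2 * w + 1) ^ (2 * r) * 2 ^ (w + 1)) +
          #𝓔 * Fintype.card (EdgeVec n) * (n + 1) ^ (2 * r) :=
        Nat.add_le_add (Nat.mul_le_mul_right _ (card_le_univ _)) (Nat.mul_le_mul_right _ hheavycount)
    _ = Fintype.card (EdgeVec n) * ((2 * w + 1) ^ (2 * r) * 2 ^ (w + 1) + #𝓔 * (n + 1) ^ (2 * r)) := by ring

/-! ### Registered form -/

/-- **stub_weakBlindDnfCount** (registered sub-goal of stmt-PneNP-18027, line `Sketch`: the counting core of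
`stub_weakBlindDnf`, closed form of `sum_card_minimals_filter_mul_le`). Summed over the failure points of a monotone
DNF `𝓔`, the inclusion-minimal missing vertex sets of size `≤ m + 1` number at most
`#EdgeVec · ((2w+1)^{2r} + #𝓔 (n+1)^{2r} / 2^{w+1})`, `r = C(m+1, 2)`, for every width cut-off `w`. [folklore] -/
theorem stub_weakBlindDnfCount : ∀ (n : ℕ) (𝓔 : Finset (Finset ((⊤ : SimpleGraph (Fin n)).edgeSet))) (m w : ℕ), (∑ x ∈ univ.filter (fun x : EdgeVec n => ¬ ∃ E ∈ 𝓔, ∀ e ∈ E, x e = true), #((Razborov.minimals (𝓔.image fun E => univ.filter fun v : Fin n => ∃ e : (⊤ : SimpleGraph (Fin n)).edgeSet, e ∈ E.filter (fun e => x e = false) ∧ v ∈ (e : Sym2 (Fin n)))).filter fun U => #U ≤ m + 1)) * 2 ^ (w + 1) ≤ Fintype.card (EdgeVec n) * ((2 * w + 1) ^ (2 * (m + 1).choose 2) * 2 ^ (w + 1) + #𝓔 * (n + 1) ^ (2 * (m + 1).choose 2)) :=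
  fun _ 𝓔 m w => sum_card_minimals_filter_mul_le 𝓔 m w

end Summit.PneNP.PneNP.Theorems.MonotoneBlind.VertexCover
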